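import Literature.Geometry.Kaehler.RiemannSurfaceArcClosedForm
import Literature.Geometry.Kaehler.RiemannSurfaceHodgeDecompositionH1
import Literature.Geometry.Kaehler.RiemannSurfacePicardGroup
import HarnessLib

/-!
# Abel's theorem, sufficiency, for chains of arcs (Forster §20.7): a chain with vanishing periods
# has principal boundary divisor

Layer `Literature/Geometry/Kaehler`, sequel of `RiemannSurfaceArcWeakSolutions` (arcs `A` in charts,
weak solutions `f_A`, forms `σ_A`, the pairing `∬ θ ∧ σ_A = -(C/2)(F(b) - F(a))` of Lemma 20.5) and
`RiemannSurfaceArcClosedForm` (a smooth closed completion `β_A = P dz + σ_A`). O. Forster, *Lectures on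
Riemann Surfaces*, GTM 81 (1981), Theorem 20.7 (ABEL's theorem), sufficiency: «Suppose `D ∈ Div(X)`,
`deg D = 0`; if there is a `1`-chain `c` with `∂c = D` and `∫_c ω = 0` for every `ω ∈ Ω(X)`, then `D`
is a principal divisor.» Forster's proof: `c = ∑ cᵢ` a sum of curves in charts, `f = ∏ fᵢ` the product
of their weak solutions (20.4, 20.5), `σ = ∑ σᵢ` with `∬ σ ∧ ω = ∫_c ω = 0` for all `ω`, hence
(Dolbeault 19.10) `σ = d″ψ`, and `F = e^{-2πiψ} f` is a meromorphic function with `(F) = D`.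

This file carries the argument out for CHAINS OF ARCS `c : ι → ArcDatum M` (finitely many straight
arcs in chart discs), with 19.10 replaced by its de Rham form (§1): the closed completion
`β = ∑ β_A = P dz + σ` is, by the Hodge decomposition of `H¹_dR(M; ℂ)`
(`RiemannSurfaceHodgeDecompositionH1`), `ω₁ dz + ω̄₂ dz̄ + dΨ`, and `∬ Im(ω₂ ∧ β) = 0` kills `ω₂` by
Riemann's inequality; so `σ` and `dΨ` have the same `dz̄`-coefficient `q`, i.e. `∂̄ψ = q`.

* §1 `exists_eq_oneZeroForm_add_mextDeriv_of_integral_im_wedge_eq_zero` — Forster 19.10 in integral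
  form: a closed smooth `β` with `∬ Im(ω ∧ β) = 0` for all holomorphic `ω` is `ω₁ dz + dΨ`.
* §2 plane lemmas: the logarithmic `∂̄`-derivative of a finite product, `∏ a^{mᵢ} = a^{∑ mᵢ}`, and
  **`meromorphicAt_and_order_eq_of_eventuallyEq_zpow_mul`**: `g = (z - z₀)^m V` on a punctured
  neighbourhood, `g` holomorphic there, `V` continuous with `V(z₀) ≠ 0` ⟹ `g` meromorphic of order `m`
  (Riemann's removable singularity theorem for `V`).
* §3 `ArcDatum.exists_unit_comp_symm_eq_zpow_mul` — the weak solution of ONE arc read in the preferred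
  chart at ANY point `x`: `f_A ∘ z_x⁻¹ = (z - z_x x)^{∂c_A(x)} V`, `V(z_x x) ≠ 0` (transition map
  `T = z_p ∘ z_x⁻¹` and `T z - T z₀ = (z - z₀) · dslope T z₀ z`).
* §4 chains: `chainDivisor = ∑ ∂cᵢ` (degree `0`), `chainForm = ∑ σᵢ`, `chainUnit = ∏ fᵢ`,
  `chainCoeff = q`; **`integral_im/re_wedge_chainForm`** (Lemma 20.5 summed);
  `exists_closed_completion_chainForm`; **`exists_eq_oneZeroForm_add_mextDeriv_of_chain`** and
  **`exists_dbar_potential`**: under the period hypothesis a function `ψ`, `C^∞` in every chart, with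
  `∂̄(ψ ∘ z_x⁻¹)(z_x x) = q(x)` everywhere.
* §5 `chainFun c ψ = (∏ fᵢ) e^{-2πiψ}`: holomorphic off the endpoints (`mdifferentiableAt_chainFun`,
  the two logarithmic `∂̄`-derivatives `±2πi q` cancel), of local form `(z - z_x x)^{∂c(x)} V` at every
  point, hence meromorphic in every chart with order `∂c(x)` (`meromorphicAt_chainFun_and_order_eq`);
  `extend`ed across the endpoints (`RiemannSurfaceMeromorphicArithmetic.mdifferentiable_extend`) it is a
  meromorphic function `F : M → ℂ ∪ {∞}` with `div F = ∂c`
  (`meromorphicOrderAt_finPart_chart`, `divisor_apply`): **`isPrincipal_chainDivisor`**.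

The period hypothesis is stated with primitives on the chart discs: for every holomorphic `θ` there
are `Fᵢ` with `Fᵢ′ = θ_{z_{pᵢ}}` on `B(c₀ᵢ, Rᵢ)` and `∑ᵢ (Fᵢ(bᵢ) - Fᵢ(aᵢ)) = 0` (Forster's
`∫_c ω = 0`; the increment does not depend on the primitive). Deriving this hypothesis from
`A(D) = 0` in `Jac(M)` (chains from the universal cover) is the remaining half of 20.7's sufficiency
and is not in this file. Everything here is proved; no named facts, no instances.

## References

* O. Forster, *Lectures on Riemann Surfaces*, GTM 81, Springer (1981), §20.4 (weak solutions),
  Lemma 20.5, Theorem 20.7 (proof), Corollary 19.10, §19.12. [Forster1981]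
* R. Miranda, *Algebraic Curves and Riemann Surfaces*, GSM 5 (1995), Chapter II Lemma 1.28
  (removable singularities / orders), Chapter V Definition 1.3 (divisor of a meromorphic function),
  Chapter IV Definition 1.2. [Miranda1995]
* L. Hörmander, *An Introduction to Complex Analysis in Several Variables* (1973), §1.1.
  [HormanderSCV1973]
* J. M. Lee, *Introduction to Smooth Manifolds*, 2nd ed. (2013), Prop. 14.11, Prop. 16.6.
  [LeeSmoothManifolds2013]
* R. O. Wells, *Differential Analysis on Complex Manifolds* (1980), Ch. I §3. [Wells1980]
* F. W. Warner, *Foundations of Differentiable Manifolds and Lie Groups* (1983), 2.15. [WarnerGTM94]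
-/

noncomputable section

open scoped Manifold ContDiff Topology ComplexConjugate Real
open Set Filter Function Complex Metric MeasureTheory
open Literature.NumberTheory.Transcendental Literature.Analysis.Complex

namespace Literature.Geometry.Kaehler

namespace RiemannSurface

variable {M : Type*} [TopologicalSpace M] [ChartedSpace ℂ M]

/-! ### §1 The integral form of Forster 19.10: `∬ Im(θ ∧ β) = 0` for all `θ` forces `β = ω₁ dz + dΨ` -/

section Orthogonality

omit [ChartedSpace ℂ M] in
/-- `Re((i/2) α) = -(1/2) Im α` for a complex form `α`. [cite: Forster1981, §19.5] -/
theorem re_I_half_smul [ChartedSpace ℂ M] {k : ℕ} (α : MForm 𝓘(ℝ, ℂ) M ℂ k) :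
    ((I / 2 : ℂ) • α).re = (-(1 / 2 : ℝ)) • α.im := by
  funext x
  ext v
  simp only [MForm.re_apply, MForm.im_apply, Pi.smul_apply,
    ContinuousAlternatingMap.smul_apply, smul_eq_mul, Complex.mul_re, Complex.div_re, Complex.I_re,
    Complex.I_im, Complex.div_im]
  norm_num

variable [ConnectedSpace M] [IsManifold 𝓘(ℂ, ℂ) ω M] [IsManifold 𝓘(ℝ, ℂ) ∞ M] [CompactSpace M]
  [T2Space M] [Fact (Module.finrank ℝ ℂ = 2)]

/-- **Forster 19.10 in integral form (de Rham version).** A smooth closed complex `1`-form `β` on a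
compact Riemann surface such that `∬_M Im(ω ∧ β) = 0` for every holomorphic `ω` is `ω₁ dz + dΨ` with
`ω₁` holomorphic and `Ψ` a smooth function: writing `β = ω₁ dz + ω̄₂ dz̄ + dΨ` (19.12), the choice
`ω = ω₂` gives `∬ Im(ω₂ ∧ ω̄₂) = 0` (the term `ω₂ dz ∧ dΨ` is exact, Stokes), i.e. `∬ (i/2) ω₂ ∧ ω̄₂ = 0`,
contradicting Riemann's inequality unless `ω₂ = 0` («the equation `d″f = σ` has a solution iff
`∬ σ ∧ ω = 0` for every `ω ∈ Ω(X)`»). [cite: Forster1981, Corollary 19.10 and §19.12] -/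
theorem exists_eq_oneZeroForm_add_mextDeriv_of_integral_im_wedge_eq_zero {β : MForm 𝓘(ℝ, ℂ) M ℂ 1}
    (hβ : β ∈ cclosedSmoothForms ℂ M 1)
    (horth : ∀ θ : ↥(holomorphicOneForms M),
      MForm.integral (fun _ : M ↦ Complex.orientation)
        ((oneZeroForm ⇑(θ : MeromorphicOneForm M)).wedge β).im = 0) :
    ∃ θ₁ : ↥(holomorphicOneForms M), ∃ Ψ : MForm 𝓘(ℝ, ℂ) M ℂ 0, IsSmoothForm Ψ ∧
      β = oneZeroForm ⇑(θ₁ : MeromorphicOneForm M) + mextDeriv Ψ := by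
  haveI : WedgeFacts 𝓘(ℝ, ℂ) M ℂ := wedgeFacts_of_comm (ContinuousAlternatingMap.WedgeComm_holds ℝ ℂ ℂ)
  have ho : IsContinuousOrientation (I := 𝓘(ℝ, ℂ)) (M := M) (fun _ ↦ Complex.orientation) :=
    Literature.AlgebraicGeometry.HodgeTheory.isContinuousOrientation_const _
  obtain ⟨θ₁, θ₂, Ψ, hΨ, hdec⟩ := exists_eq_oneZeroForm_add_zeroOneForm_add_mextDeriv hβ
  have hη : (θ₂ : MeromorphicOneForm M).IsHolomorphic := θ₂.2
  have hs1 : IsSmoothForm (oneZeroForm ⇑(θ₂ : MeromorphicOneForm M)) := hη.isSmoothForm_oneZeroForm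
  have hdΨ : IsSmoothForm (mextDeriv Ψ) := isSmoothForm_mextDeriv (inChart_mextDeriv_holds 𝓘(ℝ, ℂ) M ℂ) hΨ
  have hsw : IsSmoothForm ((oneZeroForm ⇑(θ₂ : MeromorphicOneForm M)).wedge
      (zeroOneForm (star ⇑(θ₂ : MeromorphicOneForm M)))) :=
    IsSmoothFormWedge_holds 𝓘(ℝ, ℂ) M ℂ hs1 hη.isSmoothForm_zeroOneForm_star
  have hsd : IsSmoothForm ((oneZeroForm ⇑(θ₂ : MeromorphicOneForm M)).wedge (mextDeriv Ψ)) :=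
    IsSmoothFormWedge_holds 𝓘(ℝ, ℂ) M ℂ hs1 hdΨ
  -- `ω₂ dz ∧ dΨ` is exact, so its imaginary part integrates to zero (Stokes)
  have hexact : (oneZeroForm ⇑(θ₂ : MeromorphicOneForm M)).wedge (mextDeriv Ψ) ∈
      cexactSmoothForms ℂ M (1 + 1) := by
    rw [← Submodule.restrictScalars_mem ℝ, restrictScalars_cexactSmoothForms_holds (E := ℂ) (M := M)]
    refine wedge_mem_exactSmoothForms_of_right ⟨hs1, hη.isClosedForm_oneZeroForm⟩ ?_
    rw [← restrictScalars_cexactSmoothForms_holds (E := ℂ) (M := M) 1]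
    exact Submodule.subset_span ⟨Ψ, mem_csmoothForms hΨ, rfl⟩
  obtain ⟨γ, hγs, hγ⟩ :=
    Literature.AlgebraicGeometry.HodgeTheory.exists_eq_mextDeriv_of_mem_cexactSmoothForms hexact
  have hint_d : MForm.integral (fun _ : M ↦ Complex.orientation)
      ((oneZeroForm ⇑(θ₂ : MeromorphicOneForm M)).wedge (mextDeriv Ψ)).im = 0 := by
    have hmem : ((oneZeroForm ⇑(θ₂ : MeromorphicOneForm M)).wedge (mextDeriv Ψ)).im ∈
        exactSmoothForms 𝓘(ℝ, ℂ) M ℝ (1 + 1) := by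
      rw [hγ, MForm.im_mextDeriv_holds hγs]
      exact Submodule.subset_span ⟨γ.im, hγs.im, rfl⟩
    exact MForm.integral_eq_zero_of_mem_exactSmoothForms_holds (o := fun _ : M ↦ Complex.orientation)
      ho hmem
  -- the hypothesis at `ω₂`: `∬ Im(ω₂ ∧ ω̄₂) = 0`
  have h := horth θ₂
  rw [hdec, MForm.wedge_add_right, MForm.wedge_add_right, oneZeroForm_wedge_oneZeroForm, zero_add,
    MForm.im_add, MForm.integral_add_holds _ ho hsw.im hsd.im, hint_d, add_zero] at h
  by_cases h0 : (θ₂ : MeromorphicOneForm M) = 0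
  · refine ⟨θ₁, Ψ, hΨ, ?_⟩
    rw [hdec, h0, MeromorphicOneForm.coe_zero, star_zero, zeroOneForm_zero, add_zero]
  · exfalso
    have hpos := hη.integral_normSq_pos h0
    rw [oneOneForm_I_half_mul_conj_eq, re_I_half_smul, MForm.integral_smul, h, mul_zero] at hpos
    exact lt_irrefl _ hpos

/-- The same with the hypothesis on both real and imaginary parts (the complex number
`∬ θ ∧ β = 0`). [cite: Forster1981, Corollary 19.10 and §19.12] -/
theorem exists_eq_oneZeroForm_add_mextDeriv_of_integral_wedge_eq_zero {β : MForm 𝓘(ℝ, ℂ) M ℂ 1}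
    (hβ : β ∈ cclosedSmoothForms ℂ M 1)
    (horth : ∀ θ : ↥(holomorphicOneForms M),
      MForm.integral (fun _ : M ↦ Complex.orientation)
          ((oneZeroForm ⇑(θ : MeromorphicOneForm M)).wedge β).re = 0 ∧
        MForm.integral (fun _ : M ↦ Complex.orientation)
          ((oneZeroForm ⇑(θ : MeromorphicOneForm M)).wedge β).im = 0) :
    ∃ θ₁ : ↥(holomorphicOneForms M), ∃ Ψ : MForm 𝓘(ℝ, ℂ) M ℂ 0, IsSmoothForm Ψ ∧
      β = oneZeroForm ⇑(θ₁ : MeromorphicOneForm M) + mextDeriv Ψ :=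
  exists_eq_oneZeroForm_add_mextDeriv_of_integral_im_wedge_eq_zero hβ fun θ ↦ (horth θ).2

end Orthogonality


/-! ### §2 Plane lemmas: `∂̄` of finite products, powers, removable singularities with a `zpow` factor -/

section PlaneLemmas

/-- **Logarithmic `∂̄`-derivative of a finite product**: if `∂̄gᵢ = kᵢ gᵢ` at `z` for every `i ∈ s`,
then `∏ gᵢ` is real-differentiable at `z` and `∂̄(∏ gᵢ) = (∑ kᵢ) ∏ gᵢ` there.
[cite: HormanderSCV1973, §1.1] -/
theorem differentiableAt_and_dbarAlong_finset_prod {ι : Type*} (s : Finset ι) {g : ι → ℂ → ℂ}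
    {k : ι → ℂ} {z : ℂ} (hg : ∀ i ∈ s, DifferentiableAt ℝ (g i) z)
    (hlog : ∀ i ∈ s, dbarAlong 1 (g i) z = k i * g i z) :
    DifferentiableAt ℝ (fun w ↦ ∏ i ∈ s, g i w) z ∧
      dbarAlong 1 (fun w ↦ ∏ i ∈ s, g i w) z = (∑ i ∈ s, k i) * ∏ i ∈ s, g i z := by
  classical
  induction s using Finset.induction_on with
  | empty =>
    simp only [Finset.prod_empty, Finset.sum_empty, zero_mul]
    exact ⟨differentiableAt_const _, dbarAlong_eq_zero_of_differentiableAt (differentiableAt_const _) 1⟩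
  | insert a s ha ih =>
    have hg' : ∀ i ∈ s, DifferentiableAt ℝ (g i) z := fun i hi ↦ hg i (Finset.mem_insert_of_mem hi)
    have hlog' : ∀ i ∈ s, dbarAlong 1 (g i) z = k i * g i z := fun i hi ↦
      hlog i (Finset.mem_insert_of_mem hi)
    obtain ⟨hdP, hP⟩ := ih hg' hlog'
    have hga : DifferentiableAt ℝ (g a) z := hg a (Finset.mem_insert_self a s)
    simp only [Finset.prod_insert ha, Finset.sum_insert ha]
    refine ⟨hga.mul hdP, ?_⟩
    rw [dbarAlong_one_mul hga hdP, hP, hlog a (Finset.mem_insert_self a s)]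
    ring

/-- `∏ᵢ a^{mᵢ} = a^{∑ mᵢ}` for `a ≠ 0` (integer exponents). [cite: HormanderSCV1973, §1.1] -/
theorem prod_zpow_eq_zpow_sum {ι : Type*} (s : Finset ι) {a : ℂ} (ha : a ≠ 0) (m : ι → ℤ) :
    ∏ i ∈ s, a ^ m i = a ^ ∑ i ∈ s, m i := by
  classical
  induction s using Finset.induction_on with
  | empty => simp
  | insert b s hb ih => rw [Finset.prod_insert hb, Finset.sum_insert hb, zpow_add₀ ha, ih]

/-- **Removable singularities with an integer-power factor.** If `g` is holomorphic on a punctured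
neighbourhood of `z₀` and `g = (z - z₀)^m · V` there with `V` continuous at `z₀` and `V(z₀) ≠ 0`,
then `g` is meromorphic at `z₀` of order exactly `m` (`V` is holomorphic near `z₀` by Riemann's
removable singularity theorem). [cite: Miranda1995, Chapter II Lemma 1.28] -/
theorem meromorphicAt_and_order_eq_of_eventuallyEq_zpow_mul {g V : ℂ → ℂ} {z₀ : ℂ} {m : ℤ}
    (hg : ∀ᶠ z in 𝓝[≠] z₀, DifferentiableAt ℂ g z) (hV : ContinuousAt V z₀) (hV0 : V z₀ ≠ 0)
    (heq : ∀ᶠ z in 𝓝[≠] z₀, g z = (z - z₀) ^ m * V z) :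
    MeromorphicAt g z₀ ∧ meromorphicOrderAt g z₀ = m := by
  -- `V = g · (z - z₀)^{-m}` is differentiable on a punctured neighbourhood
  have hboth : ∀ᶠ y in 𝓝[≠] z₀, ∀ᶠ z in 𝓝 y, DifferentiableAt ℂ g z ∧ g z = (z - z₀) ^ m * V z ∧
      z ≠ z₀ := by
    have h : ∀ᶠ z in 𝓝[≠] z₀, DifferentiableAt ℂ g z ∧ g z = (z - z₀) ^ m * V z ∧ z ≠ z₀ := by
      filter_upwards [hg, heq, self_mem_nhdsWithin] with z h1 h2 h3
      exact ⟨h1, h2, h3⟩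
    have h2 := eventually_eventually_nhdsWithin.2 h
    filter_upwards [h2, self_mem_nhdsWithin] with y hy (hy0 : y ≠ z₀)
    rwa [nhdsWithin_eq_nhds.2 (isOpen_compl_singleton.mem_nhds hy0)] at hy
  have hVd : ∀ᶠ y in 𝓝[≠] z₀, DifferentiableAt ℂ V y := by
    filter_upwards [hboth] with y hy
    have hy0 : DifferentiableAt ℂ g y ∧ g y = (y - z₀) ^ m * V y ∧ y ≠ z₀ := hy.self_of_nhds
    have hVeq : V =ᶠ[𝓝 y] fun z ↦ g z * (z - z₀) ^ (-m) := by
      filter_upwards [hy] with z hz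
      rw [hz.2.1, zpow_neg, mul_comm ((z - z₀) ^ m), mul_assoc,
        mul_inv_cancel₀ (zpow_ne_zero m (sub_ne_zero.2 hz.2.2)), mul_one]
    refine DifferentiableAt.congr_of_eventuallyEq ?_ hVeq
    exact hy0.1.mul ((differentiableAt_id.sub_const z₀).zpow (Or.inl (sub_ne_zero.2 hy0.2.2)))
  have hVa : AnalyticAt ℂ V z₀ :=
    Complex.analyticAt_of_differentiable_on_punctured_nhds_of_continuousAt hVd hV
  have hmer : MeromorphicAt g z₀ := by
    have hm : MeromorphicAt (fun z ↦ (z - z₀) ^ m * V z) z₀ :=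
      ((MeromorphicAt.id z₀).sub (MeromorphicAt.const z₀ z₀)).zpow m |>.mul hVa.meromorphicAt
    exact hm.congr (heq.mono fun z hz ↦ hz.symm)
  refine ⟨hmer, (meromorphicOrderAt_eq_int_iff hmer).2 ⟨V, hVa, hV0, ?_⟩⟩
  filter_upwards [heq] with z hz
  rw [hz, smul_eq_mul]

end PlaneLemmas

/-! ### §3 The weak solution of one arc near every point: `f = (z - z_x(x))^{∂c(x)} · V`, `V(z_x x) ≠ 0` -/

namespace ArcDatum

variable [IsManifold 𝓘(ℂ, ℂ) ω M] (A : ArcDatum M)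

/-- The transition map `T = z_p ∘ z_x⁻¹` into the chart of the arc is analytic at `z_x x` with
non-zero derivative, for `x` in the chart source. [cite: Miranda1995, Chapter IV Definition 1.2] -/
theorem analyticAt_transition {x : M} (hx : x ∈ (chartAt ℂ A.center).source) :
    AnalyticAt ℂ (chartAt ℂ A.center ∘ (chartAt ℂ x).symm) (chartAt ℂ x x) ∧
      deriv (chartAt ℂ A.center ∘ (chartAt ℂ x).symm) (chartAt ℂ x x) ≠ 0 := by
  refine ⟨analyticAt_coordChange (mdifferentiableOn_atlas (I := 𝓘(ℂ, ℂ)) (chart_mem_atlas ℂ A.center))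
    (mdifferentiableOn_atlas_symm (I := 𝓘(ℂ, ℂ)) (chart_mem_atlas ℂ x)) (mem_chart_target ℂ x) ?_, ?_⟩
  · rwa [(chartAt ℂ x).left_inv (mem_chart_source ℂ x)]
  · exact left_ne_zero_of_mul_eq_one (deriv_chartAt_comp_symm_mul_deriv hx)

omit [IsManifold 𝓘(ℂ, ℂ) ω M] in
/-- In the chart `z_x` at a point `x` of the chart source, the weak solution is
`((T z) - b)/((T z) - a)` near `z_x x` whenever `z_p x ∈ B(c₀, r₁)`, `T = z_p ∘ z_x⁻¹`.
[cite: Forster1981, §20.4] -/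
theorem unit_comp_symm_eventuallyEq_div_transition {x : M} (hx : x ∈ (chartAt ℂ A.center).source)
    (hb : chartAt ℂ A.center x ∈ ball A.c₀ A.r₁) :
    A.unit ∘ (chartAt ℂ x).symm =ᶠ[𝓝 (chartAt ℂ x x)] fun z ↦
      ((chartAt ℂ A.center ∘ (chartAt ℂ x).symm) z - A.tgt) /
        ((chartAt ℂ A.center ∘ (chartAt ℂ x).symm) z - A.src) := by
  have hcont : ContinuousAt (chartAt ℂ A.center ∘ (chartAt ℂ x).symm) (chartAt ℂ x x) := by
    refine ContinuousAt.comp ?_ ((chartAt ℂ x).continuousAt_symm (mem_chart_target ℂ x))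
    rw [(chartAt ℂ x).left_inv (mem_chart_source ℂ x)]
    exact (chartAt ℂ A.center).continuousAt hx
  have h1 : ∀ᶠ z in 𝓝 (chartAt ℂ x x), (chartAt ℂ x).symm z ∈ (chartAt ℂ A.center).source := by
    refine ((chartAt ℂ x).continuousAt_symm (mem_chart_target ℂ x)).eventually ?_
    rw [(chartAt ℂ x).left_inv (mem_chart_source ℂ x)]
    exact (chartAt ℂ A.center).open_source.mem_nhds hx
  have h2 : ∀ᶠ z in 𝓝 (chartAt ℂ x x), (chartAt ℂ A.center ∘ (chartAt ℂ x).symm) z ∈ ball A.c₀ A.r₁ := by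
    refine hcont.eventually ?_
    have h0 : (chartAt ℂ A.center ∘ (chartAt ℂ x).symm) (chartAt ℂ x x) = chartAt ℂ A.center x := by
      simp [(chartAt ℂ x).left_inv (mem_chart_source ℂ x)]
    rw [h0]
    exact isOpen_ball.mem_nhds hb
  filter_upwards [h1, h2] with z hz hzb
  simp only [comp_apply] at hzb ⊢
  rw [A.unit_of_mem hz, planeUnit, arcUnit_of_mem hzb]

/-- **Local structure of the weak solution of an arc at every point**: in the chart `z_x`,
`f ∘ z_x⁻¹ = (z - z_x x)^{∂c(x)} · V` on a punctured neighbourhood, with `V` continuous at `z_x x` and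
`V(z_x x) ≠ 0` (`∂c(b') = 1`: a simple zero; `∂c(a') = -1`: a simple pole; `∂c = 0` elsewhere: a unit).
[cite: Forster1981, §20.4 (Definition of a weak solution)] -/
theorem exists_unit_comp_symm_eq_zpow_mul [T2Space M] (x : M) :
    ∃ V : ℂ → ℂ, ContinuousAt V (chartAt ℂ x x) ∧ V (chartAt ℂ x x) ≠ 0 ∧
      ∀ᶠ z in 𝓝[≠] (chartAt ℂ x x),
        (A.unit ∘ (chartAt ℂ x).symm) z = (z - chartAt ℂ x x) ^ (A.divisor x) * V z := by
  set z₀ := chartAt ℂ x x with hz₀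
  set T : ℂ → ℂ := chartAt ℂ A.center ∘ (chartAt ℂ x).symm with hT
  by_cases h2 : x = A.tgtPt
  · -- simple zero at `b'`
    subst h2
    have hx := A.tgtPt_mem_source
    obtain ⟨hTa, hT'⟩ := A.analyticAt_transition hx
    have hTb : T z₀ = A.tgt := by simp [hT, hz₀, (chartAt ℂ A.tgtPt).left_inv (mem_chart_source ℂ _)]
    have hba : A.tgt - A.src ≠ 0 := sub_ne_zero.2 A.src_ne_tgt.symm
    refine ⟨fun z ↦ dslope T z₀ z / (T z - A.src), ?_, ?_, ?_⟩
    · refine (continuousAt_dslope_same.2 hTa.differentiableAt).div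
        (hTa.continuousAt.sub continuousAt_const) ?_
      rwa [hTb]
    · show dslope T z₀ z₀ / (T z₀ - A.src) ≠ 0
      rw [dslope_same, hTb]
      exact div_ne_zero hT' hba
    · have hev := A.unit_comp_symm_eventuallyEq_div_transition hx (by
        rw [chartAt_tgtPt]; exact A.tgt_mem_ball_r₁)
      filter_upwards [hev.filter_mono nhdsWithin_le_nhds, self_mem_nhdsWithin] with z hz (hzz : z ≠ z₀)
      rw [hz, divisor_tgtPt, zpow_one]
      change (T z - A.tgt) / (T z - A.src) = (z - z₀) * (dslope T z₀ z / (T z - A.src))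
      rw [← hTb, ← sub_smul_dslope T z₀ z, smul_eq_mul]
      ring
  by_cases h1 : x = A.srcPt
  · -- simple pole at `a'`
    subst h1
    have hx := A.srcPt_mem_source
    obtain ⟨hTa, hT'⟩ := A.analyticAt_transition hx
    have hTa' : T z₀ = A.src := by simp [hT, hz₀, (chartAt ℂ A.srcPt).left_inv (mem_chart_source ℂ _)]
    have hab : A.src - A.tgt ≠ 0 := sub_ne_zero.2 A.src_ne_tgt
    have hds : ContinuousAt (dslope T z₀) z₀ := continuousAt_dslope_same.2 hTa.differentiableAt
    have hds0 : dslope T z₀ z₀ ≠ 0 := by rwa [dslope_same]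
    refine ⟨fun z ↦ (T z - A.tgt) / dslope T z₀ z, ?_, ?_, ?_⟩
    · exact (hTa.continuousAt.sub continuousAt_const).div hds hds0
    · show (T z₀ - A.tgt) / dslope T z₀ z₀ ≠ 0
      rw [dslope_same, hTa']
      exact div_ne_zero hab hT'
    · have hev := A.unit_comp_symm_eventuallyEq_div_transition hx (by
        rw [chartAt_srcPt]; exact A.src_mem_ball_r₁)
      have hne : ∀ᶠ z in 𝓝 z₀, dslope T z₀ z ≠ 0 := hds.eventually_ne hds0
      filter_upwards [hev.filter_mono nhdsWithin_le_nhds, hne.filter_mono nhdsWithin_le_nhds,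
        self_mem_nhdsWithin] with z hz hzne (hzz : z ≠ z₀)
      rw [hz, divisor_srcPt, zpow_neg, zpow_one]
      change (T z - A.tgt) / (T z - A.src) = (z - z₀)⁻¹ * ((T z - A.tgt) / dslope T z₀ z)
      have hTz : T z - A.src = (z - z₀) * dslope T z₀ z := by
        rw [← hTa', ← sub_smul_dslope T z₀ z, smul_eq_mul]
      rw [hTz]
      have hzz' : z - z₀ ≠ 0 := sub_ne_zero.2 hzz
      field_simp
  · -- a unit elsewhere
    refine ⟨A.unit ∘ (chartAt ℂ x).symm, (A.contDiffAt_unit_comp_symm h1).continuousAt, ?_, ?_⟩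
    · show A.unit ((chartAt ℂ x).symm (chartAt ℂ x x)) ≠ 0
      rw [(chartAt ℂ x).left_inv (mem_chart_source ℂ x)]
      exact A.unit_ne_zero h1 h2
    · filter_upwards with z
      rw [A.divisor_of_ne h1 h2, zpow_zero, one_mul]

end ArcDatum

/-! ### §4 Chains of arcs: divisor, form, weak solution, closed completion, the `∂̄`-potential -/

section Chain

variable {ι : Type*} [Fintype ι]

/-- **The divisor `∂c = ∑ᵢ ∂cᵢ` of a chain of arcs.** [cite: Forster1981, §20.4] -/
def chainDivisor (c : ι → ArcDatum M) : M →₀ ℤ := ∑ i, (c i).divisor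

/-- **The `(0,1)`-form `σ = ∑ᵢ σᵢ` of a chain** (of the weak solution `∏ fᵢ`). [cite: Forster1981, §20.5, proof (b)] -/
def chainForm (c : ι → ArcDatum M) : MForm 𝓘(ℝ, ℂ) M ℂ 1 := ∑ i, (c i).form

/-- **The weak solution `f = ∏ᵢ fᵢ` of `∂c` for a chain `c = ∑ cᵢ`.** [cite: Forster1981, §20.5, proof (b)] -/
def chainUnit (c : ι → ArcDatum M) : M → ℂ := fun x ↦ ∏ i, (c i).unit x

/-- The `dz̄`-coefficient `q = ∑ᵢ qᵢ` of `σ` against the frames of the preferred charts.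
[cite: Forster1981, §20.5, proof (b)] -/
def chainCoeff (c : ι → ArcDatum M) : M → ℂ := fun x ↦ ∑ i, chartCoeffBar (c i).center (c i).coeff x

/-- The endpoints of a chain. [cite: Forster1981, §20.4] -/
def IsEndpoint (c : ι → ArcDatum M) (x : M) : Prop := ∃ i, x = (c i).srcPt ∨ x = (c i).tgtPt

variable (c : ι → ArcDatum M)

/-- `∂c(x) = ∑ᵢ ∂cᵢ(x)`. [cite: Forster1981, §20.4] -/
theorem chainDivisor_apply (x : M) : chainDivisor c x = ∑ i, (c i).divisor x := by
  rw [chainDivisor, Finsupp.finsetSum_apply]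

/-- `∂c(x) = 0` off the endpoints. [cite: Forster1981, §20.4] -/
theorem chainDivisor_apply_of_not_isEndpoint {x : M} (hx : ¬ IsEndpoint c x) : chainDivisor c x = 0 := by
  rw [chainDivisor_apply]
  refine Finset.sum_eq_zero fun i _ ↦ (c i).divisor_of_ne ?_ ?_
  · exact fun h ↦ hx ⟨i, Or.inl h⟩
  · exact fun h ↦ hx ⟨i, Or.inr h⟩

/-- `deg ∂c = 0`. [cite: Forster1981, §20.4] -/
theorem degree_chainDivisor : Finsupp.degree (chainDivisor c) = 0 := by
  rw [chainDivisor, map_sum]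
  exact Finset.sum_eq_zero fun i _ ↦ (c i).degree_divisor

/-- The set of endpoints is finite. [cite: Forster1981, §20.4] -/
theorem finite_setOf_isEndpoint : {x | IsEndpoint c x}.Finite := by
  have h : {x | IsEndpoint c x} ⊆ (Set.range fun i ↦ (c i).srcPt) ∪ Set.range fun i ↦ (c i).tgtPt := by
    rintro x ⟨i, h | h⟩
    · exact Or.inl ⟨i, h.symm⟩
    · exact Or.inr ⟨i, h.symm⟩
  exact ((Set.finite_range _).union (Set.finite_range _)).subset h

/-- The weak solution of a chain does not vanish off the endpoints. [cite: Forster1981, §20.4] -/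
theorem chainUnit_ne_zero {x : M} (hx : ¬ IsEndpoint c x) : chainUnit c x ≠ 0 :=
  Finset.prod_ne_zero_iff.2 fun i _ ↦ (c i).unit_ne_zero (fun h ↦ hx ⟨i, Or.inl h⟩)
    (fun h ↦ hx ⟨i, Or.inr h⟩)

omit [Fintype ι] in
/-- `α ∧ (∑ βᵢ) = ∑ α ∧ βᵢ`. [cite: LeeSmoothManifolds2013, Prop. 14.11] -/
theorem _root_.Literature.Geometry.Kaehler.MForm.wedge_finset_sum_right {k l : ℕ}
    (α : MForm 𝓘(ℝ, ℂ) M ℂ k) (s : Finset ι) (β : ι → MForm 𝓘(ℝ, ℂ) M ℂ l) :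
    α.wedge (∑ i ∈ s, β i) = ∑ i ∈ s, α.wedge (β i) := by
  classical
  induction s using Finset.induction_on with
  | empty =>
    simp only [Finset.sum_empty]
    have h := MForm.wedge_add_right α (0 : MForm 𝓘(ℝ, ℂ) M ℂ l) 0
    rw [add_zero] at h
    exact left_eq_add.1 h
  | insert a s ha ih => rw [Finset.sum_insert ha, Finset.sum_insert ha, MForm.wedge_add_right, ih]

omit [Fintype ι] in
/-- `Im (∑ αᵢ) = ∑ Im αᵢ`. [cite: Wells1980, Ch. I §3] -/
theorem _root_.Literature.Geometry.Kaehler.MForm.im_finset_sum {k : ℕ} (s : Finset ι)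
    (α : ι → MForm 𝓘(ℝ, ℂ) M ℂ k) : (∑ i ∈ s, α i).im = ∑ i ∈ s, (α i).im := by
  classical
  induction s using Finset.induction_on with
  | empty =>
    simp only [Finset.sum_empty]
    funext x; ext v; simp
  | insert a s ha ih => rw [Finset.sum_insert ha, Finset.sum_insert ha, MForm.im_add, ih]

omit [Fintype ι] in
/-- `(∑ Pᵢ) dz = ∑ Pᵢ dz`. [cite: Forster1981, §9.8] -/
theorem oneZeroForm_finset_sum (s : Finset ι) (P : ι → M → ℂ) :
    oneZeroForm (∑ i ∈ s, P i) = ∑ i ∈ s, oneZeroForm (P i) := by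
  classical
  induction s using Finset.induction_on with
  | empty => simp
  | insert a s ha ih => rw [Finset.sum_insert ha, Finset.sum_insert ha, oneZeroForm_add, ih]

omit [Fintype ι] in
/-- `coeffZeroOne (∑ αᵢ) = ∑ coeffZeroOne αᵢ`. [cite: Forster1981, §9.8] -/
theorem coeffZeroOne_finset_sum (s : Finset ι) (α : ι → MForm 𝓘(ℝ, ℂ) M ℂ 1) :
    coeffZeroOne (∑ i ∈ s, α i) = ∑ i ∈ s, coeffZeroOne (α i) := by
  classical
  induction s using Finset.induction_on with
  | empty => simp
  | insert a s ha ih => rw [Finset.sum_insert ha, Finset.sum_insert ha, coeffZeroOne_add, ih]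

/-- `coeffZeroOne σ = q`. [cite: Forster1981, §20.5, proof (b)] -/
theorem coeffZeroOne_chainForm : coeffZeroOne (chainForm c) = chainCoeff c := by
  rw [chainForm, coeffZeroOne_finset_sum]
  funext x
  simp only [Finset.sum_apply, chainCoeff, ArcDatum.coeffZeroOne_form]

variable [IsManifold 𝓘(ℂ, ℂ) ω M] [IsManifold 𝓘(ℝ, ℂ) ∞ M] [T2Space M]

/-- `σ` is smooth. [cite: Forster1981, §20.5, proof (b)] -/
theorem isSmoothForm_chainForm : IsSmoothForm (chainForm c) :=
  (smoothForms 𝓘(ℝ, ℂ) M ℂ 1).sum_mem fun i _ ↦ (c i).isSmoothForm_form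

variable [CompactSpace M]

section Pairing

variable [Fact (Module.finrank ℝ ℂ = 2)]

/-- **Lemma 20.5 for a chain**: `∬_M Im(θ ∧ σ) = -(C/2) Im ∑ᵢ (Fᵢ(bᵢ) - Fᵢ(aᵢ))` for a holomorphic
`θ` and primitives `Fᵢ` of `θ_{z_{pᵢ}}` on the discs of the arcs. [cite: Forster1981, Lemma 20.5] -/
theorem integral_im_wedge_chainForm {θ : MeromorphicOneForm M} (hθ : θ.IsHolomorphic) {F : ι → ℂ → ℂ}
    (hF : ∀ i, ∀ z ∈ ball (c i).c₀ (c i).R, HasDerivAt (F i) (θ.localExpr (chartAt ℂ (c i).center) z) z) :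
    MForm.integral (fun _ : M ↦ Complex.orientation) ((oneZeroForm ⇑θ).wedge (chainForm c)).im =
      -(chartIntegralConst / 2) * (∑ i, (F i (c i).tgt - F i (c i).src)).im := by
  have ho : IsContinuousOrientation (I := 𝓘(ℝ, ℂ)) (M := M) (fun _ ↦ Complex.orientation) :=
    Literature.AlgebraicGeometry.HodgeTheory.isContinuousOrientation_const _
  have hs : ∀ i ∈ (Finset.univ : Finset ι), IsSmoothForm ((oneZeroForm ⇑θ).wedge (c i).form).im :=
    fun i _ ↦ (IsSmoothFormWedge_holds 𝓘(ℝ, ℂ) M ℂ hθ.isSmoothForm_oneZeroForm (c i).isSmoothForm_form).im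
  rw [chainForm, MForm.wedge_finset_sum_right, MForm.im_finset_sum,
    MForm.integral_finset_sum_of_isSmoothForm _ ho _ hs, Complex.im_sum, Finset.mul_sum]
  exact Finset.sum_congr rfl fun i _ ↦ (c i).integral_im_wedge_form hθ (hF i)

/-- Real part of `integral_im_wedge_chainForm`. [cite: Forster1981, Lemma 20.5] -/
theorem integral_re_wedge_chainForm {θ : MeromorphicOneForm M} (hθ : θ.IsHolomorphic) {F : ι → ℂ → ℂ}
    (hF : ∀ i, ∀ z ∈ ball (c i).c₀ (c i).R, HasDerivAt (F i) (θ.localExpr (chartAt ℂ (c i).center) z) z) :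
    MForm.integral (fun _ : M ↦ Complex.orientation) ((oneZeroForm ⇑θ).wedge (chainForm c)).re =
      -(chartIntegralConst / 2) * (∑ i, (F i (c i).tgt - F i (c i).src)).re := by
  have ho : IsContinuousOrientation (I := 𝓘(ℝ, ℂ)) (M := M) (fun _ ↦ Complex.orientation) :=
    Literature.AlgebraicGeometry.HodgeTheory.isContinuousOrientation_const _
  have hs : ∀ i ∈ (Finset.univ : Finset ι), IsSmoothForm ((oneZeroForm ⇑θ).wedge (c i).form).re :=
    fun i _ ↦ (IsSmoothFormWedge_holds 𝓘(ℝ, ℂ) M ℂ hθ.isSmoothForm_oneZeroForm (c i).isSmoothForm_form).re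
  have hre : ∀ (s : Finset ι) (α : ι → MForm 𝓘(ℝ, ℂ) M ℂ 2),
      (∑ i ∈ s, α i).re = ∑ i ∈ s, (α i).re := by
    intro s α
    classical
    induction s using Finset.induction_on with
    | empty =>
      simp only [Finset.sum_empty]
      funext x; ext v; simp
    | insert a s ha ih => rw [Finset.sum_insert ha, Finset.sum_insert ha, MForm.re_add, ih]
  rw [chainForm, MForm.wedge_finset_sum_right, hre, MForm.integral_finset_sum_of_isSmoothForm _ ho _ hs,
    Complex.re_sum, Finset.mul_sum]
  exact Finset.sum_congr rfl fun i _ ↦ (c i).integral_re_wedge_form hθ (hF i)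

end Pairing

variable [ConnectedSpace M]

/-- **A closed completion of `σ`**: `β = P dz + σ` smooth and closed, summing the closed forms of the
arcs (`ArcDatum.exists_closedForm`). [cite: Forster1981, §20.5 and Theorem 20.7 (proof)] -/
theorem exists_closed_completion_chainForm :
    ∃ β : MForm 𝓘(ℝ, ℂ) M ℂ 1, β ∈ cclosedSmoothForms ℂ M 1 ∧ ∃ P : M → ℂ, β = oneZeroForm P + chainForm c := by
  have h : ∀ i, ∃ β : MForm 𝓘(ℝ, ℂ) M ℂ 1, IsSmoothForm β ∧ (∀ x, mextDeriv β x = 0) ∧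
      ∃ P : M → ℂ, β = oneZeroForm P + (c i).form := fun i ↦ (c i).exists_closedForm
  choose β hβs hβc P hβP using h
  refine ⟨∑ i, β i, Submodule.sum_mem _ fun i _ ↦ mem_cclosedSmoothForms (hβs i) (funext (hβc i)),
    ∑ i, P i, ?_⟩
  rw [oneZeroForm_finset_sum, chainForm, ← Finset.sum_add_distrib]
  exact Finset.sum_congr rfl fun i _ ↦ hβP i

variable [Fact (Module.finrank ℝ ℂ = 2)]

/-- **Forster 20.7, the `∂̄`-potential of a chain with vanishing periods.** If for every holomorphic
`θ` the sum `∑ᵢ (Fᵢ(bᵢ) - Fᵢ(aᵢ))` of the increments of primitives along the arcs vanishes (Forster: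
`∫_c ω = 0` for all `ω ∈ Ω(X)`), then `σ = ω₁-part + dΨ`: precisely, there are a holomorphic `ω₁`, a
coefficient `P` and a smooth function `Ψ` with `P dz + σ = ω₁ dz + dΨ`.
[cite: Forster1981, Theorem 20.7 (proof, sufficiency)] -/
theorem exists_eq_oneZeroForm_add_mextDeriv_of_chain
    (hc : ∀ θ : ↥(holomorphicOneForms M), ∃ F : ι → ℂ → ℂ,
      (∀ i, ∀ z ∈ ball (c i).c₀ (c i).R,
        HasDerivAt (F i) ((θ : MeromorphicOneForm M).localExpr (chartAt ℂ (c i).center) z) z) ∧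
      ∑ i, (F i (c i).tgt - F i (c i).src) = 0) :
    ∃ P : M → ℂ, ∃ θ₁ : ↥(holomorphicOneForms M), ∃ Ψ : MForm 𝓘(ℝ, ℂ) M ℂ 0, IsSmoothForm Ψ ∧
      oneZeroForm P + chainForm c = oneZeroForm ⇑(θ₁ : MeromorphicOneForm M) + mextDeriv Ψ := by
  haveI : WedgeFacts 𝓘(ℝ, ℂ) M ℂ := wedgeFacts_of_comm (ContinuousAlternatingMap.WedgeComm_holds ℝ ℂ ℂ)
  obtain ⟨β, hβ, P, hβP⟩ := exists_closed_completion_chainForm c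
  have horth : ∀ θ : ↥(holomorphicOneForms M), MForm.integral (fun _ : M ↦ Complex.orientation)
      ((oneZeroForm ⇑(θ : MeromorphicOneForm M)).wedge β).im = 0 := by
    intro θ
    obtain ⟨F, hF, hsum⟩ := hc θ
    rw [hβP, MForm.wedge_add_right, oneZeroForm_wedge_oneZeroForm, zero_add,
      integral_im_wedge_chainForm c θ.2 hF, hsum, Complex.zero_im, mul_zero]
  obtain ⟨θ₁, Ψ, hΨ, h⟩ := exists_eq_oneZeroForm_add_mextDeriv_of_integral_im_wedge_eq_zero hβ horth
  exact ⟨P, θ₁, Ψ, hΨ, hβP ▸ h⟩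

omit [IsManifold 𝓘(ℂ, ℂ) ω M] [CompactSpace M] [ConnectedSpace M] [Fact (Module.finrank ℝ ℂ = 2)] [T2Space M] in
/-- A smooth `0`-form read in any chart is a `C^∞` function on the chart target.
[cite: WarnerGTM94, 2.15] -/
theorem contDiffAt_apply_vecEmpty_comp_symm {Ψ : MForm 𝓘(ℝ, ℂ) M ℂ 0} (hΨ : IsSmoothForm Ψ) (p : M)
    {z : ℂ} (hz : z ∈ (chartAt ℂ p).target) :
    ContDiffAt ℝ ∞ ((fun y ↦ Ψ y ![]) ∘ (chartAt ℂ p).symm) z := by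
  set y := (chartAt ℂ p).symm z with hy
  have hys : y ∈ (extChartAt 𝓘(ℝ, ℂ) p).source := by
    rw [extChartAt_source]; exact (chartAt ℂ p).map_target hz
  have h := (MForm.smoothAt_iff_contDiffWithinAt_inChart hys).1 ((isSmoothForm_iff_smoothAt _).1 hΨ y)
  rw [ModelWithCorners.Boundaryless.range_eq_univ, contDiffWithinAt_univ] at h
  have hpy : extChartAt 𝓘(ℝ, ℂ) p y = z := by simp [hy, (chartAt ℂ p).right_inv hz]
  rw [hpy, ← MForm.ofFun_apply_vecEmpty Ψ, MForm.inChart_ofFun] at h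
  have h2 := (ContinuousAlternatingMap.constOfIsEmptyLIE ℝ ℂ ℂ (Fin 0)).toContinuousLinearEquiv
    |>.comp_contDiffAt_iff.1 h
  refine h2.congr_of_eventuallyEq (Eventually.of_forall fun w ↦ ?_)
  simp only [comp_apply]
  rfl

/-- **The `∂̄`-potential of a chain with vanishing periods**: a function `ψ`, `C^∞` in every chart,
with `∂̄(ψ ∘ z_x⁻¹)(z_x x) = q(x)` (the `dz̄`-coefficient of `σ`) at every point, in the frame of the
preferred chart `z_x` — Forster's `∂̄ψ = σ` after subtracting the holomorphic part.
[cite: Forster1981, Theorem 20.7 (proof, sufficiency)] -/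
theorem exists_dbar_potential
    (hc : ∀ θ : ↥(holomorphicOneForms M), ∃ F : ι → ℂ → ℂ,
      (∀ i, ∀ z ∈ ball (c i).c₀ (c i).R,
        HasDerivAt (F i) ((θ : MeromorphicOneForm M).localExpr (chartAt ℂ (c i).center) z) z) ∧
      ∑ i, (F i (c i).tgt - F i (c i).src) = 0) :
    ∃ ψ : M → ℂ, (∀ (p : M) (z : ℂ), z ∈ (chartAt ℂ p).target → ContDiffAt ℝ ∞ (ψ ∘ (chartAt ℂ p).symm) z) ∧
      ∀ x, dbarAlong 1 (ψ ∘ (chartAt ℂ x).symm) (chartAt ℂ x x) = chainCoeff c x := by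
  obtain ⟨P, θ₁, Ψ, hΨ, h⟩ := exists_eq_oneZeroForm_add_mextDeriv_of_chain c hc
  refine ⟨fun y ↦ Ψ y ![], fun p z hz ↦ contDiffAt_apply_vecEmpty_comp_symm hΨ p hz, fun x ↦ ?_⟩
  have hq := congrArg (fun α ↦ coeffZeroOne α x) h
  simp only [coeffZeroOne_add, coeffZeroOne_oneZeroForm, zero_add, coeffZeroOne_chainForm,
    Pi.add_apply, Pi.zero_apply] at hq
  rw [hq, ← coeffZeroOne_mextDeriv_ofFun, MForm.ofFun_apply_vecEmpty]

end Chain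


/-! ### §5 The meromorphic function `f = (∏ fᵢ) e^{-2πiψ}` and `IsPrincipal ∂c` (Theorem 20.7, sufficiency, for chains) -/

section Principal

variable {ι : Type*} [Fintype ι] (c : ι → ArcDatum M)

/-- **The candidate meromorphic function `f = (∏ᵢ fᵢ) · e^{-2πi ψ}` of a chain and a potential `ψ`.**
[cite: Forster1981, Theorem 20.7 (proof, sufficiency)] -/
def chainFun (ψ : M → ℂ) : M → ℂ := fun x ↦ chainUnit c x * exp (-(2 * π * I) * ψ x)

variable [IsManifold 𝓘(ℂ, ℂ) ω M] [T2Space M]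

/-- **`f` is holomorphic off the endpoints** when `∂̄ψ = q` there: in the chart `z_x`,
`∂̄(∏ fᵢ) = 2πi q ∏ fᵢ` (`dbarAlong_unit`) and `∂̄ e^{-2πiψ} = -2πi q e^{-2πiψ}` cancel.
[cite: Forster1981, Theorem 20.7 (proof, sufficiency)] -/
theorem mdifferentiableAt_chainFun {ψ : M → ℂ} {x : M} (hx : ¬ IsEndpoint c x)
    (hψd : DifferentiableAt ℝ (ψ ∘ (chartAt ℂ x).symm) (chartAt ℂ x x))
    (hψ : dbarAlong 1 (ψ ∘ (chartAt ℂ x).symm) (chartAt ℂ x x) = chainCoeff c x) :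
    MDifferentiableAt 𝓘(ℂ, ℂ) 𝓘(ℂ, ℂ) (chainFun c ψ) x := by
  set e := chartAt ℂ x with he
  have h1 : ∀ i, x ≠ (c i).srcPt := fun i h ↦ hx ⟨i, Or.inl h⟩
  -- the product of the weak solutions
  obtain ⟨hPd, hP⟩ := differentiableAt_and_dbarAlong_finset_prod (Finset.univ : Finset ι)
    (g := fun i ↦ (c i).unit ∘ e.symm) (k := fun i ↦ 2 * π * I * chartCoeffBar (c i).center (c i).coeff x)
    (z := e x) (fun i _ ↦ (c i).differentiableAt_unit_comp_symm (h1 i)) (fun i _ ↦ by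
      rw [(c i).dbarAlong_unit (h1 i), comp_apply, e.left_inv (mem_chart_source ℂ x)]; ring)
  -- the exponential factor
  have hlin : DifferentiableAt ℝ (fun z ↦ -(2 * π * I) * (ψ ∘ e.symm) z) (e x) :=
    (differentiableAt_const _).mul hψd
  have hEd : DifferentiableAt ℝ (fun z ↦ exp (-(2 * π * I) * (ψ ∘ e.symm) z)) (e x) :=
    (Complex.differentiable_exp (𝕜 := ℝ)).differentiableAt.comp (e x) hlin
  have hE : dbarAlong 1 (fun z ↦ exp (-(2 * π * I) * (ψ ∘ e.symm) z)) (e x) =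
      exp (-(2 * π * I) * (ψ ∘ e.symm) (e x)) * (-(2 * π * I) * chainCoeff c x) := by
    rw [dbarAlong_one_cexp hlin, dbarAlong_const_mul' hψd, hψ]
  have hfd : DifferentiableAt ℝ (chainFun c ψ ∘ e.symm) (e x) := hPd.mul hEd
  refine mdifferentiableAt_of_dbarAlong_eq_zero hfd ?_
  change dbarAlong 1 (fun z ↦ (∏ i, ((c i).unit ∘ e.symm) z) *
    exp (-(2 * π * I) * (ψ ∘ e.symm) z)) (e x) = 0
  rw [dbarAlong_one_mul hPd hEd, hP, hE, chainCoeff, ← Finset.mul_sum]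
  ring

/-- **Local structure of `f` at every point**: in the chart `z_x`, `f ∘ z_x⁻¹ = (z - z_x x)^{∂c(x)} · V`
on a punctured neighbourhood with `V` continuous at `z_x x`, `V(z_x x) ≠ 0` (product of the local
structures of the `fᵢ` and the non-vanishing factor `e^{-2πiψ}`). [cite: Forster1981, §20.4 and Theorem 20.7 (proof)] -/
theorem exists_chainFun_comp_symm_eq_zpow_mul {ψ : M → ℂ} (x : M)
    (hψc : ContinuousAt (ψ ∘ (chartAt ℂ x).symm) (chartAt ℂ x x)) :
    ∃ V : ℂ → ℂ, ContinuousAt V (chartAt ℂ x x) ∧ V (chartAt ℂ x x) ≠ 0 ∧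
      ∀ᶠ z in 𝓝[≠] (chartAt ℂ x x),
        (chainFun c ψ ∘ (chartAt ℂ x).symm) z = (z - chartAt ℂ x x) ^ (chainDivisor c x) * V z := by
  set e := chartAt ℂ x with he
  set z₀ := e x with hz₀
  have h : ∀ i, ∃ V : ℂ → ℂ, ContinuousAt V z₀ ∧ V z₀ ≠ 0 ∧ ∀ᶠ z in 𝓝[≠] z₀,
      ((c i).unit ∘ e.symm) z = (z - z₀) ^ ((c i).divisor x) * V z := fun i ↦
    (c i).exists_unit_comp_symm_eq_zpow_mul x
  choose V hVc hV0 hV using h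
  set E : ℂ → ℂ := fun z ↦ exp (-(2 * π * I) * (ψ ∘ e.symm) z) with hE
  have hEc : ContinuousAt E z₀ := (Complex.continuous_exp.continuousAt).comp (continuousAt_const.mul hψc)
  refine ⟨fun z ↦ (∏ i, V i z) * E z, ?_, ?_, ?_⟩
  · exact (tendsto_finsetProd _ fun i _ ↦ hVc i).mul hEc
  · exact mul_ne_zero (Finset.prod_ne_zero_iff.2 fun i _ ↦ hV0 i) (Complex.exp_ne_zero _)
  · have hall : ∀ᶠ z in 𝓝[≠] z₀, ∀ i, ((c i).unit ∘ e.symm) z = (z - z₀) ^ ((c i).divisor x) * V i z :=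
      Filter.eventually_all.2 hV
    filter_upwards [hall, self_mem_nhdsWithin] with z hz (hzz : z ≠ z₀)
    change (∏ i, ((c i).unit ∘ e.symm) z) * E z = (z - z₀) ^ (chainDivisor c x) * ((∏ i, V i z) * E z)
    rw [Finset.prod_congr rfl fun i _ ↦ hz i, Finset.prod_mul_distrib,
      prod_zpow_eq_zpow_sum _ (sub_ne_zero.2 hzz), chainDivisor_apply]
    ring

omit [IsManifold 𝓘(ℂ, ℂ) ω M] [T2Space M] in
/-- The punctured neighbourhoods of a point avoid the (finitely many) endpoints. [cite: Forster1981, §20.4] -/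
theorem eventually_not_isEndpoint [T1Space M] (x : M) : ∀ᶠ y in 𝓝[≠] x, ¬ IsEndpoint c y := by
  have hS := finite_setOf_isEndpoint c
  have h : ∀ᶠ y in 𝓝[≠] x, y ∈ ({y | IsEndpoint c y} ∩ {x}ᶜ)ᶜ :=
    mem_nhdsWithin_of_mem_nhds ((hS.subset inter_subset_left).isClosed.isOpen_compl.mem_nhds (by simp))
  filter_upwards [h, self_mem_nhdsWithin] with y hy (hyx : y ≠ x)
  simp only [mem_compl_iff, mem_inter_iff, mem_setOf_eq, not_and, not_not] at hy
  exact fun h' ↦ hyx (hy h')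

/-- **`f` is meromorphic in every chart with order `∂c(x)`** when it is holomorphic off the endpoints
(Riemann's removable singularity theorem applied to `V`). [cite: Forster1981, Theorem 20.7 (proof)] -/
theorem meromorphicAt_chainFun_and_order_eq {ψ : M → ℂ}
    (hhol : ∀ y, ¬ IsEndpoint c y → MDifferentiableAt 𝓘(ℂ, ℂ) 𝓘(ℂ, ℂ) (chainFun c ψ) y) (x : M)
    (hψc : ContinuousAt (ψ ∘ (chartAt ℂ x).symm) (chartAt ℂ x x)) :
    MeromorphicAt (chainFun c ψ ∘ (chartAt ℂ x).symm) (chartAt ℂ x x) ∧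
      meromorphicOrderAt (chainFun c ψ ∘ (chartAt ℂ x).symm) (chartAt ℂ x x) = (chainDivisor c x : ℤ) := by
  obtain ⟨V, hVc, hV0, hV⟩ := exists_chainFun_comp_symm_eq_zpow_mul c x hψc
  refine meromorphicAt_and_order_eq_of_eventuallyEq_zpow_mul ?_ hVc hV0 hV
  -- holomorphy on a punctured chart neighbourhood
  have h1 : ∀ᶠ z in 𝓝[≠] (chartAt ℂ x x), ¬ IsEndpoint c ((chartAt ℂ x).symm z) :=
    (tendsto_chartAt_symm_nhdsNE x).eventually (eventually_not_isEndpoint c x)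
  have h2 : ∀ᶠ z in 𝓝[≠] (chartAt ℂ x x), z ∈ (chartAt ℂ x).target :=
    mem_nhdsWithin_of_mem_nhds ((chartAt ℂ x).open_target.mem_nhds (mem_chart_target ℂ x))
  filter_upwards [h1, h2] with z hz hzt
  have h := differentiableAt_comp_symm ((chartAt ℂ x).map_target hzt) (hhol _ hz)
  rwa [(chartAt ℂ x).right_inv hzt] at h

omit [IsManifold 𝓘(ℂ, ℂ) ω M] [T2Space M] [Fintype ι] in
/-- A Riemann surface has a point that is not an endpoint of the chain (chart sources are infinite).
[cite: Forster1981, §20.4] -/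
theorem exists_not_isEndpoint [Fintype ι] [Nonempty M] : ∃ x : M, ¬ IsEndpoint c x := by
  obtain ⟨x₀⟩ := ‹Nonempty M›
  set e := chartAt ℂ x₀ with he
  have hinf : (e.target : Set ℂ).Infinite :=
    infinite_of_mem_nhds (e x₀) (e.open_target.mem_nhds (mem_chart_target ℂ x₀))
  have hinj : InjOn e.symm e.target := fun a ha b hb hab ↦ by
    rw [← e.right_inv ha, ← e.right_inv hb, hab]
  have hinf' : (e.symm '' e.target).Infinite := hinf.image hinj
  obtain ⟨y, -, hy⟩ := (hinf'.sdiff (finite_setOf_isEndpoint c)).nonempty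
  exact ⟨y, hy⟩

variable [IsManifold 𝓘(ℝ, ℂ) ∞ M] [CompactSpace M] [ConnectedSpace M] [Fact (Module.finrank ℝ ℂ = 2)]

/-- **Abel's theorem, sufficiency, for chains (Forster 20.7).** On a compact connected Riemann
surface, if a chain of arcs `c = ∑ cᵢ` has vanishing periods — for every holomorphic `ω` the sum of
the increments `∑ᵢ (Fᵢ(bᵢ) - Fᵢ(aᵢ)) = ∫_c ω` of local primitives vanishes — then its boundary divisor
`∂c = ∑ᵢ (bᵢ' - aᵢ')` is principal: `∂c = (f)` for the meromorphic function
`f = (∏ᵢ fᵢ) e^{-2πiψ}`, `fᵢ` the weak solutions of the arcs and `ψ` the `∂̄`-potential of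
`σ = ∑ σᵢ` corrected by a holomorphic form (Forster's proof of 20.7 with 20.4, 20.5; Dolbeault 19.10
replaced by the de Rham decomposition of `H¹`). [cite: Forster1981, Theorem 20.7] -/
theorem isPrincipal_chainDivisor
    (hc : ∀ θ : ↥(holomorphicOneForms M), ∃ F : ι → ℂ → ℂ,
      (∀ i, ∀ z ∈ ball (c i).c₀ (c i).R,
        HasDerivAt (F i) ((θ : MeromorphicOneForm M).localExpr (chartAt ℂ (c i).center) z) z) ∧
      ∑ i, (F i (c i).tgt - F i (c i).src) = 0) :
    IsPrincipal (chainDivisor c) := by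
  classical
  by_cases hD : chainDivisor c = 0
  · rw [hD]; exact isPrincipal_zero
  obtain ⟨ψ, hψs, hψ⟩ := exists_dbar_potential c hc
  set f := chainFun c ψ with hf
  set S : Set M := {x | IsEndpoint c x} with hS_def
  have hS : S.Finite := finite_setOf_isEndpoint c
  have hψc : ∀ x : M, ContinuousAt (ψ ∘ (chartAt ℂ x).symm) (chartAt ℂ x x) := fun x ↦
    (hψs x _ (mem_chart_target ℂ x)).continuousAt
  have hhol : ∀ x, ¬ IsEndpoint c x → MDifferentiableAt 𝓘(ℂ, ℂ) 𝓘(ℂ, ℂ) f x := fun x hx ↦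
    mdifferentiableAt_chainFun c hx ((hψs x _ (mem_chart_target ℂ x)).differentiableAt (by simp)) (hψ x)
  have hloc := fun x ↦ meromorphicAt_chainFun_and_order_eq c hhol x (hψc x)
  -- the meromorphic function `F = extend f`
  set F := extend f with hF_def
  have hcont : ∀ x ∉ S, ContinuousAt f x := fun x hx ↦ (hhol x hx).continuousAt
  have hF : MDifferentiable 𝓘(ℂ, ℂ) 𝓘(ℂ, ℂ) F :=
    mdifferentiable_extend hS (fun x hx ↦ hhol x hx) fun p _ ↦ (hloc p).1
  have hval : ∀ x ∉ S, F x = (f x : OnePoint ℂ) := fun x hx ↦ extend_of_continuousAt (hcont x hx)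
  have hfne : ∀ x ∉ S, f x ≠ 0 := fun x hx ↦
    mul_ne_zero (chainUnit_ne_zero c hx) (Complex.exp_ne_zero _)
  -- a regular point with a finite non-zero value
  obtain ⟨x₁, hx₁⟩ := exists_not_isEndpoint c
  have hx₁v : F x₁ ≠ ((0 : ℂ) : OnePoint ℂ) ∧ F x₁ ≠ (OnePoint.infty : OnePoint ℂ) := by
    rw [hval x₁ hx₁]
    exact ⟨fun h ↦ hfne x₁ hx₁ (OnePoint.coe_injective h), OnePoint.coe_ne_infty _⟩
  -- `F` is not constant: at a point of `∂c` the chart germ has non-zero order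
  have hne : ∃ a b, F a ≠ F b := by
    obtain ⟨x₀, hx₀⟩ : ∃ x₀, chainDivisor c x₀ ≠ 0 := by
      by_contra h
      push Not at h
      exact hD (Finsupp.ext h)
    by_contra hcon
    push Not at hcon
    -- then `f` is eventually the non-zero constant `f x₁` near `x₀` (punctured)
    have hev : f =ᶠ[𝓝[≠] x₀] fun _ ↦ f x₁ := by
      filter_upwards [eventually_not_isEndpoint c x₀] with y hy
      have h := hcon y x₁
      rw [hval y hy, hval x₁ hx₁] at h
      exact OnePoint.coe_injective h
    have hord := (hloc x₀).2
    rw [meromorphicOrderAt_congr (eventuallyEq_nhdsNE_chart hev)] at hord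
    change meromorphicOrderAt (fun _ ↦ f x₁) _ = _ at hord
    rw [meromorphicOrderAt_const, if_neg (hfne x₁ hx₁)] at hord
    exact hx₀ (by exact_mod_cast hord.symm)
  refine ⟨F, hF, ⟨x₁, hx₁v⟩, Finsupp.ext fun p ↦ ?_⟩
  -- `div(F)(p) = ord_p(F) = ∂c(p)`
  rw [divisor_apply hF hne]
  have h1 := meromorphicOrderAt_finPart_chart (hF p).continuousAt (Eventually.of_forall fun y ↦ hF y)
    (ramificationNumber_pos_of_exists_ne hF hne p)
  rw [meromorphicOrderAt_congr (eventuallyEq_nhdsNE_chart (finPart_extend_eventuallyEq hS hcont p)),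
    (hloc p).2] at h1
  exact_mod_cast h1.symm

end Principal

end RiemannSurface

end Literature.Geometry.Kaehler

end
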